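import Summits.FinalStateConjecture.FinalStateConjecture.Theses.TemporalBandLiouville

/-!
# Birth skeleton for crux `TemporalBandLiouville.BandFromNonradiation` (stmt-FinalStateConjecture-10172)

planner-skel-stmt-FinalStateConjecture-10172-0 · skeleton-register (BC3, one-shot) · 2026-08-17.
Route `route-FinalStateConjecture-TemporalBandLiouville` (rev 2), crux #3 (rank 3, OPEN / open-problem):
BAND FROM NON-RADIATION (card K1) — every vacuum metric `G` of the ETERNAL HARMONIC VACUUM EXTERIOR
class (components in one global chart on the eternal excised cylinder `ℝ_t × Kerr.region a r₀`,
uniformly spacelike slices, inflow excision collar, `Ric = 0`, harmonic gauge, two-sided uniform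
`C^k` bounds, asymptotically flat at STATIONARY rates uniformly in `t`) is BAND-LIMITED IN TIME:
`∃ b C`, every orbit component `s ↦ G(x + s e₀)(v,w)` is the restriction of an entire `F` with
`‖F z‖ ≤ C‖v‖‖w‖e^{b|Im z|}`.

## The line — the route header's own two-layer plan for C1, typed (RELLICH ZONE → TUBE ANALYTICITY → SPECTRUM EDGE)

The crux is cut along the one geometric seam every source agrees on: the FAR ZONE `{|x⃗| > R}`,
where non-radiation alone already forces stationarity (Papapetrou; Bičák–Scholtz–Tod; Alexakis–Schlue
arXiv:1504.04592 Thm 1.1 (time-periodic) / Thm 1.3 (non-radiating, strong regularity at 𝓘); unique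
continuation from infinity, Alexakis–Schlue–Shao doi:10.1016/j.aim.2015.08.028), versus the WORLD
TUBE `{|x⃗| ≤ R}` containing the photon region, the ergo-belt, the horizon and the collar, where the
card's mechanism (high frequencies ride null geodesics; backward they come from 𝓘⁻, from the
horizon side, or sit on the trapped set — all three excluded for an eternal two-sided-bounded
non-radiating solution) has to act. Inside the tube the regularity ladder of the route is kept as two
separate rungs, so that the route's own KILL CRITERION ("time-analytic in a strip but NOT band-limited
kills C1 only: restate C1 to the strip conclusion") becomes a checkable stub boundary:

* S1 `stub_farZoneStationarity` — Hyp ⇒ `∃ R`, `G` is EXACTLY `t`-independent on `{|x⃗| > R}`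
  (the Rellich zone WITHOUT any analyticity input; AS-type).
* S2 `stub_tubeTimeAnalyticity` — Hyp + far-stationary beyond `R` ⇒ uniform STRIP analyticity in `t`
  on the tube (`∃ σ > 0, C`; HighFrequencyVacuity in Gevrey-1 form: the stationary analytic far bath
  plus two-sided eternal bounds SLAVE the trapped/horizon content — red-shift and unstable trapping as
  dissipation in both time directions, Foias–Temam style).
* S3 `stub_tubeSpectrumEdge` — Hyp + far-stationary + strip-analytic on the tube ⇒ BAND-LIMITED on the
  tube (SpectrumEdge: autonomy of the reduced vacuum system + Titchmarsh support inflation; the most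
  attackable rung, isolated on purpose).

Composition `BandFromNonradiation_of : S1 → S2 → S3 → BandFromNonradiation` is kernel-checked and does
the far-zone half itself: on `{|x⃗| > R}` the orbit is constant, the CONSTANT function
`F ≡ G x (v,w)` is entire, and `‖G x v w‖ ≤ ‖G x‖‖v‖‖w‖ ≤ C₀‖v‖‖w‖ ≤ C₀‖v‖‖w‖e^{b|Im z|}` by the
`k = 0` clause of the `C^k` bound (`‖iteratedFDeriv ℝ 0 G x‖ = ‖G x‖`) — BC5-in-kind: the band
clause is inhabited by the definitions on every stationary orbit; the tube half comes from S3 and the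
two pairs of constants are merged (`max b 0`, `max C' (max C₀ 0)`). `bandFromNonradiation_iff`
records that the vocabulary (`IsEternalExterior`) is DEFINITIONALLY the crux's antecedent.

Disproof.lean: none exists for this crux (`ledger crux ls stmt-FinalStateConjecture-10172`: no
workfiles, 2026-08-17) — no `_false_without_<H>` obligation to honour; no dead lines. Negatives index
(`ledger negatives --problem FinalStateConjecture`, 1 item: 10045 `UniformPhotonSphereChannels`, an
ODE channel statement): no stub restates it. Catalogued barriers touched: `AretakisInstability`
(extremal horizons carry conserved non-decaying hair — S2's red-shift leg needs `κ > 0`; the collar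
clause `g⁻¹(dr,dr) ≤ −c₀` excludes exactly-extremal Kerr but not near-extremal limits, so S2 is where
it bites), `SbierskiTrappingObstruction` / stable trapping (Keir arXiv:1404.7036 quasimodes: S2 fails
for an eternal exterior with STABLY trapped null geodesics unless eternity + exact non-radiation
excludes them), `IonescuKlainermanNonExtension` (nothing here is continued across a characteristic
horizon). Honest dependence (the crux's own): a vacuum breather carries all harmonics, so S3 (and C1)
most likely fail exactly when X fails.
-/

noncomputable section

set_option linter.dupNamespace false

namespace Summit.FinalStateConjecture.FinalStateConjecture.Cruxes.BandFromNonradiation.Birth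

open Literature.Geometry.Lorentzian
open Summit.FinalStateConjecture.FinalStateConjecture.Theses.TemporalBandLiouville

/-- Local notation: a field of metric components `x ↦ g_x(·,·)` in ONE global chart on `E4`. -/
local notation "Comp" => (E4 → E4 →L[ℝ] E4 →L[ℝ] ℝ)

/-! ## Vocabulary (definitional abbreviations of the crux's own clauses) -/

/-- **The ETERNAL HARMONIC VACUUM EXTERIOR class** `Hyp(a, r₀, G)` — VERBATIM the 7-clause antecedent
shared by `EternalExteriorStationary` (X), `BandLimitedLiouville` (C2) and `BandFromNonradiation`
(C1): `r₀ > 0`; `G` a metric on `Kerr.region a r₀`; slices uniformly spacelike and an inflow excision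
collar; `Ric(G) = 0`; harmonic coordinates; every `C^k` norm of `G` and `‖G⁻¹‖` bounded on the whole
cylinder; stationary fall-off rates `C/ρ, C/ρ², C/ρ³` for `G − η, DG, D²G`. -/
def IsEternalExterior (a r₀ : ℝ) (G : Comp) : Prop :=
  0 < r₀ ∧ MetricCoord.IsMetricOn G (Kerr.region a r₀ : Set E4) ∧
  (∃ c₀ δ : ℝ, 0 < c₀ ∧ 0 < δ ∧ ∀ x ∈ Kerr.region a r₀,
    (E4.dx 0) (MetricCoord.sharpAt G x (E4.dx 0)) ≤ -c₀ ∧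
    (Kerr.radius a x < r₀ + δ →
      (fderiv ℝ (Kerr.radius a) x) (MetricCoord.sharpAt G x (fderiv ℝ (Kerr.radius a) x)) ≤ -c₀ ∧
      c₀ ≤ (E4.dx 0) (MetricCoord.sharpAt G x (fderiv ℝ (Kerr.radius a) x)))) ∧
  (∀ x ∈ Kerr.region a r₀, MetricCoord.ricAt G x = 0) ∧
  (∀ x ∈ Kerr.region a r₀, ∑ β : Fin 4,
    MetricCoord.chrAt G x (MetricCoord.sharpAt G x (E4.dx β)) (E4.basisVector β) = 0) ∧
  (∀ k : ℕ, ∃ C : ℝ, ∀ x ∈ Kerr.region a r₀,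
    ‖iteratedFDeriv ℝ k G x‖ ≤ C ∧ ‖MetricCoord.sharpAt G x‖ ≤ C) ∧
  (∃ C : ℝ, ∀ x ∈ Kerr.region a r₀, ‖G x - Minkowski.bilin‖ ≤ C / E4.spatialNorm x ∧
    ‖iteratedFDeriv ℝ 1 G x‖ ≤ C / E4.spatialNorm x ^ 2 ∧
    ‖iteratedFDeriv ℝ 2 G x‖ ≤ C / E4.spatialNorm x ^ 3)

/-- **Far-zone stationarity beyond radius `R`**: on `Kerr.region a r₀ ∩ {|x⃗| > R}` every time
orbit of `G` is constant (`∂_t = e₀` is Killing there, in the given chart). -/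
def FarStationary (a r₀ R : ℝ) (G : Comp) : Prop :=
  ∀ x ∈ Kerr.region a r₀, R < E4.spatialNorm x → ∀ s : ℝ, G (x + s • E4.basisVector 0) = G x

/-- **Uniform strip analyticity in `t` on the tube `{|x⃗| ≤ R}`** (half-width `σ`, bound `C`): every
orbit component `s ↦ G(x + s e₀)(v,w)`, `x` in the tube, is the restriction of a function holomorphic
on `{|Im z| < σ}` and bounded there by `C‖v‖‖w‖` — verbatim the analyticity clause of the route's
support item `StaticZoneLiouville`, localised to the tube. -/
def StripAnalyticOn (a r₀ R σ C : ℝ) (G : Comp) : Prop :=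
  ∀ x ∈ Kerr.region a r₀, E4.spatialNorm x ≤ R → ∀ v w : E4, ∃ F : ℂ → ℂ,
    DifferentiableOn ℂ F {z : ℂ | |z.im| < σ} ∧ (∀ z : ℂ, |z.im| < σ → ‖F z‖ ≤ C * ‖v‖ * ‖w‖) ∧
      ∀ s : ℝ, F (s : ℂ) = ((G (x + s • E4.basisVector 0) v w : ℝ) : ℂ)

/-- **Band-limitation on the tube `{|x⃗| ≤ R}`** (type `b`, bound `C`): every orbit component, `x` in
the tube, is the restriction of an ENTIRE function with `‖F z‖ ≤ C‖v‖‖w‖e^{b|Im z|}` — verbatim the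
crux's conclusion clause, localised to the tube. -/
def BandLimitedOn (a r₀ R b C : ℝ) (G : Comp) : Prop :=
  ∀ x ∈ Kerr.region a r₀, E4.spatialNorm x ≤ R → ∀ v w : E4, ∃ F : ℂ → ℂ,
    Differentiable ℂ F ∧ (∀ z : ℂ, ‖F z‖ ≤ C * ‖v‖ * ‖w‖ * Real.exp (b * |z.im|)) ∧
      ∀ s : ℝ, F (s : ℂ) = ((G (x + s • E4.basisVector 0) v w : ℝ) : ℂ)

/-! ## The stub statements -/

/-- **S1 — FAR-ZONE STATIONARITY (the Rellich zone, no analyticity input).** For every `G` of the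
eternal harmonic vacuum exterior class there is a radius `R` beyond which `G` is exactly
`t`-independent. -/
def FarZoneStationarity : Prop :=
  ∀ (a r₀ : ℝ) (G : Comp), IsEternalExterior a r₀ G → ∃ R : ℝ, FarStationary a r₀ R G

/-- **S2 — TUBE TIME-ANALYTICITY from a stationary far bath.** If `G` is in the class and exactly
stationary beyond `R`, then inside the tube `{|x⃗| ≤ R}` it is time-analytic in a UNIFORM strip. -/
def TubeTimeAnalyticity : Prop :=
  ∀ (a r₀ R : ℝ) (G : Comp), IsEternalExterior a r₀ G → FarStationary a r₀ R G →
    ∃ σ C : ℝ, 0 < σ ∧ StripAnalyticOn a r₀ R σ C G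

/-- **S3 — TUBE SPECTRUM EDGE (strip ⇒ band).** If `G` is in the class, stationary beyond `R` and
uniformly strip-analytic in `t` on the tube, then it is band-limited in `t` on the tube. -/
def TubeSpectrumEdge : Prop :=
  ∀ (a r₀ R σ C : ℝ) (G : Comp), IsEternalExterior a r₀ G → FarStationary a r₀ R G → 0 < σ →
    StripAnalyticOn a r₀ R σ C G → ∃ b C' : ℝ, BandLimitedOn a r₀ R b C' G

/-! ## The stubs S1–S3 (the only `sorry`s of the file) -/

/-- **S1 `stub_farZoneStationarity`** — size L / open beyond the periodic case. WHY PLAUSIBLY TRUE: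
the fall-off clause says `DG = O(ρ⁻²)`, `D²G = O(ρ⁻³)` UNIFORMLY IN `t ∈ ℝ`: the radiation field
(the `ρ⁻¹` part of `DG` along outgoing AND incoming null directions) vanishes for all retarded and all
advanced times — no energy enters or leaves, ever. Alexakis–Schlue prove exactly "non-radiating ⇒
stationary near (portions of) 𝓘^±" (arXiv:1504.04592 = doi:10.4310/jdg/1513998029: Thm 1.1 for a
discrete time isometry, Thm 1.3 for non-radiating spacetimes under strong regularity at 𝓘), by
extending a candidate Killing field from infinity with the Carleman estimates of Alexakis–Schlue–Shao
(doi:10.1016/j.aim.2015.08.028; positive mass weakens the vanishing order needed at 𝓘); the far zone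
has no trapping, so nothing obstructs the sweep down to a finite `R`. Uniformity of `R` in `t` is the
eternal two-sided version (the bounds are `t`-uniform). That the Killing field is the chart's own
`∂_t = e₀`: it is asymptotically a unit Minkowski time translation; a boost is excluded because the
system is confined for all `t ∈ ℝ` to the FIXED excised cylinder with `G − η = O(ρ⁻¹)` uniformly in
`t` (zero velocity), and the residual harmonic-gauge freedom inside the class is itself an eternal
non-radiating wave map, stationary by the same theorem. WHY IT MIGHT FAIL: AS Thm 1.3 needs a full
asymptotic expansion at null infinity (smooth-compactification level); the typed class fixes
stationary RATES only through `D²G` (`C/ρ³`) plus rate-free `C^k` bounds — interpolation gives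
`DᵏG = O(ρ^{-3+ε})`, not `O(ρ^{-k-1})` — so the infinite-order non-radiation AS–Shao need on Minkowski
backgrounds must come from the vacuum equations themselves (positive mass helps: finite order).
Leans on: `MetricCoord.ricAt/chrAt/sharpAt`, `Kerr.region`, `E4.spatialNorm`; cite facts wanted later
(AS Thm 1.3, AS–Shao Carleman estimate near 𝓘). [arXiv:1504.04592 Thm 1.1, 1.3;
doi:10.1016/j.aim.2015.08.028; doi:10.1088/0264-9381/27/5/055007; doi:10.1002/andp.19574550709] -/
theorem stub_farZoneStationarity : FarZoneStationarity := by
  sorry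

/-- **S2 `stub_tubeTimeAnalyticity`** — OPEN (hardest; the crux's physical content in Gevrey-1 form;
= the route header's HighFrequencyVacuity with the honest target "uniform strip", i.e. temporal
spectrum decaying like `e^{-σ|λ|}`, instead of the `O(λ^{-∞})` tail the `C^k` clause already gives).
WHY PLAUSIBLY TRUE: with the far zone EXACTLY stationary (S1) — hence real-analytic in `x⃗` there
(Müller zum Hagen doi:10.1017/s0305004100001237, `∂_t` timelike far out) and trivially entire in `t` —
all time dependence of `G` lives in the tube, where `h = ∂_t G` solves the linearisation of the
AUTONOMOUS harmonic-gauge reduced vacuum system about `G` exactly. Backward (and forward) in time the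
content of `h` near the future (past) horizon is slaved to the tube's exterior history up to errors
`e^{-κT}` (red-shift as dissipation, Dafermos–Rodnianski arXiv:0811.0354 §3–4), and the content near a
NORMALLY HYPERBOLIC trapped set is slaved up to `e^{-νT/2}` (resolvent gap, Wunsch–Zworski
doi:10.1007/s00023-011-0108-1; Dyatlov arXiv:1305.1723); letting `T → ∞` — legitimate only for an
ETERNAL solution bounded on all of `ℝ_t` — the whole tube solution is an exact functional of the
stationary analytic bath, and iterating the slaving estimate on `∂_t^k G` is the Foias–Temam route from
a dissipative slaving to Gevrey-1 = strip analyticity in `t` (doi:10.1016/0022-1236(89)90015-3), here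
with the red-shift/trapping gap in the role of viscosity. WHY IT MIGHT FAIL: (i) the red-shift leg
needs `κ > 0` — the collar clause excludes exactly-extremal Kerr (no region with `dr` timelike) but
near-extremal members have arbitrarily weak red-shift and Aretakis-type horizon hair is conserved, not
slaved (Literature.Barriers.FinalStateConjecture.AretakisInstability); (ii) a non-Kerr eternal exterior
may trap STABLY (Keir arXiv:1404.7036: quasimodes with `O(λ^{-∞})` leakage), and then no gap, no
slaving, and Gevrey-1 is exactly what fails; (iii) Foias–Temam needs an analytic nonlinearity AND a
genuinely smoothing semigroup — the reduced Einstein flow is hyperbolic, smoothing only through the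
eternal two-sided squeeze, for which no theorem exists. Leans on: S1's `FarStationary`; cite facts
wanted later (DR red-shift multiplier, WZ normally-hyperbolic resolvent bound, MzH analyticity).
[arXiv:0811.0354; doi:10.1007/s00023-011-0108-1; arXiv:1305.1723; arXiv:1404.7036;
doi:10.1016/0022-1236(89)90015-3; doi:10.1017/s0305004100001237; doi:10.1007/bf01388563] -/
theorem stub_tubeTimeAnalyticity : TubeTimeAnalyticity := by
  sorry

/-- **S3 `stub_tubeSpectrumEdge`** — OPEN (the route header's SpectrumEdge; deliberately isolated: it
is the rung the route's KILL CRITERION names — "strip-analytic but not band-limited kills C1 only"). WHY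
PLAUSIBLY TRUE (the card's bet): once `G` is strip-analytic in `t` on the tube and stationary outside
it, the route's C2 technology applies INSIDE C1: Fourier in `t` is honest (spectral measures decay like
`e^{-σ|λ|}`), `h = ∂_t G` vanishes identically on the far zone, and the Tataru–Robbiano–Zuily–Hörmander
theorem for operators analytic in `t` (doi:10.1080/03605309508821117; doi:10.4171/jems/854 case (E))
continues `h ≡ 0` inward across every non-characteristic surface on which `∂_t` is timelike — so
OUTSIDE THE ERGO-BELT AND THE COLLAR the tube is already stationary (band type `b = 0`); on the
belt/collar the temporal spectrum of the polynomialised vacuum operator `P = det(g)²Ric` (homogeneous of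
degree 8 in the 2-jet) is fed, above any level `8Λ`, only by the spectrum of `G` above `Λ`, and the
Titchmarsh–Lions convolution-support theorem (Hörmander ALPDO I Thm 4.3.3; Komech–Kopylova
arXiv:1810.09047 Thm 2, 6; Komech–Komech arXiv:math/0609013) is the card's engine for turning
"`P(G) = 0` with exponentially small spectral tails against a stationary surrounding" into "compact
spectrum". WHY IT MIGHT FAIL: Titchmarsh inflation is an identity between convex hulls of supports of
COMPACTLY supported distributions — it sharpens a known edge, it does not create one; for merely
strip-analytic `G` the honest output may be "stationary off the belt, strip-analytic on it" and no
more (sine-Gordon breathers: eternal, exponentially localised, strip-analytic in `t`, ALL harmonics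
present — the analogue of S3 is false there precisely because the analogue of X is). Leans on:
`StaticZoneLiouville` (route support item 10175, same strip clause), cite facts wanted later
(Titchmarsh–Lions, Tataru–RZH). [arXiv:1810.09047 Thm 2, 6; arXiv:math/0609013;
doi:10.1080/03605309508821117; doi:10.4171/jems/854; doi:10.4310/jdg/1513998029] -/
theorem stub_tubeSpectrumEdge : TubeSpectrumEdge := by
  sorry

/-! ## Name-keyed aliases of the three statements — the hypotheses of `BandFromNonradiation_of`

The native skeleton audit (`#h21_check_skeleton`, run by `ledger skeleton check`) admits a hypothesis of
the composing theorem only if its head constant is a registered obligation or is NAMED like a declared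
stub; `__Registered.stub_X` is statement `X` under the registered stub's short name (device of
`AnomalousDissipation/…/Cruxes/MirrorFloorTG/Lines/birth.lean`; the `__` namespace is an implementation
detail, so the audit's stub report resolves each `stub_…` to the sorried theorem, not to its alias).
Each alias is an `abbrev`, definitionally its statement. -/
namespace __Registered

/-- Alias of `FarZoneStationarity` keyed by the registered stub name. -/
abbrev stub_farZoneStationarity : Prop := FarZoneStationarity
/-- Alias of `TubeTimeAnalyticity` keyed by the registered stub name. -/
abbrev stub_tubeTimeAnalyticity : Prop := TubeTimeAnalyticity
/-- Alias of `TubeSpectrumEdge` keyed by the registered stub name. -/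
abbrev stub_tubeSpectrumEdge : Prop := TubeSpectrumEdge

end __Registered

/-! ## Proved: the vocabulary is the crux; the far-zone (stationary-orbit) case of the band clause;
monotonicity of the band clause in its constants; the composition -/

/-- **The vocabulary is DEFINITIONALLY the crux**: `BandFromNonradiation` says that every `G` of the
eternal harmonic vacuum exterior class is band-limited in `t` with constants uniform on the cylinder. -/
theorem bandFromNonradiation_iff :
    BandFromNonradiation ↔
      ∀ (a r₀ : ℝ) (G : Comp), IsEternalExterior a r₀ G →
        ∃ b C : ℝ, ∀ x ∈ Kerr.region a r₀, ∀ v w : E4, ∃ F : ℂ → ℂ,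
          Differentiable ℂ F ∧ (∀ z : ℂ, ‖F z‖ ≤ C * ‖v‖ * ‖w‖ * Real.exp (b * |z.im|)) ∧
            ∀ s : ℝ, F (s : ℂ) = ((G (x + s • E4.basisVector 0) v w : ℝ) : ℂ) :=
  Iff.rfl

/-- **BC5-in-kind — the band clause on a STATIONARY orbit.** If the time orbit of `G` through `x` is
constant and `‖G x‖ ≤ C`, then for every type `b ≥ 0` the CONSTANT function `F ≡ G x (v,w)` is an entire
extension of the orbit component obeying `‖F z‖ ≤ C‖v‖‖w‖e^{b|Im z|}`. (This is the whole far-zone half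
of the crux once S1 holds.) -/
theorem band_of_stationaryOrbit {G : Comp} {x : E4} {b C : ℝ}
    (hstat : ∀ s : ℝ, G (x + s • E4.basisVector 0) = G x) (hb : 0 ≤ b) (hC : ‖G x‖ ≤ C)
    (v w : E4) :
    ∃ F : ℂ → ℂ, Differentiable ℂ F ∧
      (∀ z : ℂ, ‖F z‖ ≤ C * ‖v‖ * ‖w‖ * Real.exp (b * |z.im|)) ∧
        ∀ s : ℝ, F (s : ℂ) = ((G (x + s • E4.basisVector 0) v w : ℝ) : ℂ) := by
  refine ⟨fun _ => ((G x v w : ℝ) : ℂ), differentiable_const _, fun z => ?_, fun s => ?_⟩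
  · have h1 : ‖((G x v w : ℝ) : ℂ)‖ = ‖G x v w‖ := Complex.norm_real _
    have h2 : ‖G x v w‖ ≤ ‖G x‖ * ‖v‖ * ‖w‖ := (G x).le_opNorm₂ v w
    have h3 : ‖G x‖ * ‖v‖ * ‖w‖ ≤ C * ‖v‖ * ‖w‖ :=
      mul_le_mul_of_nonneg_right (mul_le_mul_of_nonneg_right hC (norm_nonneg v)) (norm_nonneg w)
    have h4 : (1 : ℝ) ≤ Real.exp (b * |z.im|) := Real.one_le_exp (mul_nonneg hb (abs_nonneg _))
    have h0 : (0 : ℝ) ≤ ‖G x‖ * ‖v‖ * ‖w‖ := by positivity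
    have h5 : (0 : ℝ) ≤ C * ‖v‖ * ‖w‖ := h0.trans h3
    calc ‖((G x v w : ℝ) : ℂ)‖ = ‖G x v w‖ := h1
      _ ≤ ‖G x‖ * ‖v‖ * ‖w‖ := h2
      _ ≤ C * ‖v‖ * ‖w‖ := h3
      _ = C * ‖v‖ * ‖w‖ * 1 := (mul_one _).symm
      _ ≤ C * ‖v‖ * ‖w‖ * Real.exp (b * |z.im|) := mul_le_mul_of_nonneg_left h4 h5
  · show ((G x v w : ℝ) : ℂ) = ((G (x + s • E4.basisVector 0) v w : ℝ) : ℂ)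
    rw [hstat s]

/-- **Monotonicity of the band clause in its constants**: type `b ≤ b'` and bound `C ≤ C'` with
`0 ≤ C'` may replace `(b, C)` (used to merge the tube constants of S3 with the far-zone ones). -/
theorem band_mono {G : Comp} {x : E4} {b C b' C' : ℝ} (hb : b ≤ b') (hC : C ≤ C') (hC' : 0 ≤ C')
    (v w : E4)
    (h : ∃ F : ℂ → ℂ, Differentiable ℂ F ∧
      (∀ z : ℂ, ‖F z‖ ≤ C * ‖v‖ * ‖w‖ * Real.exp (b * |z.im|)) ∧
        ∀ s : ℝ, F (s : ℂ) = ((G (x + s • E4.basisVector 0) v w : ℝ) : ℂ)) :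
    ∃ F : ℂ → ℂ, Differentiable ℂ F ∧
      (∀ z : ℂ, ‖F z‖ ≤ C' * ‖v‖ * ‖w‖ * Real.exp (b' * |z.im|)) ∧
        ∀ s : ℝ, F (s : ℂ) = ((G (x + s • E4.basisVector 0) v w : ℝ) : ℂ) := by
  obtain ⟨F, hF, hbound, hres⟩ := h
  refine ⟨F, hF, fun z => (hbound z).trans ?_, hres⟩
  have h1 : Real.exp (b * |z.im|) ≤ Real.exp (b' * |z.im|) :=
    Real.exp_le_exp.mpr (mul_le_mul_of_nonneg_right hb (abs_nonneg _))
  have h2 : C * ‖v‖ * ‖w‖ ≤ C' * ‖v‖ * ‖w‖ :=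
    mul_le_mul_of_nonneg_right (mul_le_mul_of_nonneg_right hC (norm_nonneg _)) (norm_nonneg _)
  have h3 : (0 : ℝ) ≤ C' * ‖v‖ * ‖w‖ := mul_nonneg (mul_nonneg hC' (norm_nonneg _)) (norm_nonneg _)
  calc C * ‖v‖ * ‖w‖ * Real.exp (b * |z.im|)
      ≤ C' * ‖v‖ * ‖w‖ * Real.exp (b * |z.im|) := mul_le_mul_of_nonneg_right h2 (Real.exp_pos _).le
    _ ≤ C' * ‖v‖ * ‖w‖ * Real.exp (b' * |z.im|) := mul_le_mul_of_nonneg_left h1 h3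

/-! ## The composition: `BandFromNonradiation` from S1–S3 (kernel-checked; no `sorry` of its own) -/

/-- **`BandFromNonradiation` from the three stub statements.** Given `G` in the class: S1 yields the
Rellich radius `R`; S2 the uniform strip `(σ, C₁)` on the tube; S3 the tube band `(b, C₂)`. On the far
zone `{|x⃗| > R}` the orbit through `x` is constant (S1), so the constant extension works with any type
`≥ 0` and bound `≥ ‖G x‖`, and `‖G x‖ = ‖iteratedFDeriv ℝ 0 G x‖ ≤ C₀` by the `k = 0` clause of the
`C^k` bound. Answer: `(max b 0, max C₂ (max C₀ 0))`, uniform on the whole cylinder. -/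
theorem BandFromNonradiation_of :
    __Registered.stub_farZoneStationarity → __Registered.stub_tubeTimeAnalyticity →
      __Registered.stub_tubeSpectrumEdge → BandFromNonradiation := by
  intro hfar hstrip hedge
  rw [bandFromNonradiation_iff]
  intro a r₀ G hE
  obtain ⟨R, hR⟩ := hfar a r₀ G hE
  obtain ⟨σ, C₁, hσ, hS⟩ := hstrip a r₀ R G hE hR
  obtain ⟨b, C₂, hB⟩ := hedge a r₀ R σ C₁ G hE hR hσ hS
  obtain ⟨C₀, hC₀⟩ := hE.2.2.2.2.2.1 0
  refine ⟨max b 0, max C₂ (max C₀ 0), fun x hx v w => ?_⟩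
  by_cases hρ : E4.spatialNorm x ≤ R
  · -- the tube: S3's entire extension, constants weakened
    exact band_mono (le_max_left b 0) (le_max_left C₂ _)
      ((le_max_right C₀ 0).trans (le_max_right C₂ _)) v w (hB x hx hρ v w)
  · -- the far zone: the orbit is constant (S1), the constant extension works
    have hstat : ∀ s : ℝ, G (x + s • E4.basisVector 0) = G x := hR x hx (lt_of_not_ge hρ)
    have hGx : ‖G x‖ ≤ max C₂ (max C₀ 0) := by
      have h0 : ‖iteratedFDeriv ℝ 0 G x‖ ≤ C₀ := (hC₀ x hx).1
      rw [norm_iteratedFDeriv_zero] at h0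
      exact h0.trans ((le_max_left C₀ 0).trans (le_max_right C₂ _))
    exact band_of_stationaryOrbit hstat (le_max_right b 0) hGx v w

/-- WIRING CHECK: the three sorried stubs compose to a closed term of the crux's type (modulo their
`sorry`s). Deliberately an `example` (no constant enters the environment), so that a BC3 probe cannot
close `stub → BandFromNonradiation` by `exact?` through a pre-composed witness. -/
example : BandFromNonradiation :=
  BandFromNonradiation_of stub_farZoneStationarity stub_tubeTimeAnalyticity stub_tubeSpectrumEdge

end Summit.FinalStateConjecture.FinalStateConjecture.Cruxes.BandFromNonradiation.Birth

end
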